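/-
Copyright (c) 2026 the pub-hodgecm-mathlib formalisation cell (harness21).  Prover seat hodgecm-mathlib-K2E2-p13 (g3), HCML Track B «K2-LIT» (build stream 29),
h413 = `stmt-HodgeConjecture-24833`, line `K2_E3_EllipticInputs`, unit U12 «Characters», socket #11 road (11-SC), letter (SC-an), road «FC» (finite conjugation
measure), brick (FC-5) «DIAGONAL COLLISION MEASURE» ((SC-an) lead K2E3-p14 (g4) RULINGS #15 (R15-3) ∕ #18; dealer K2E3-plan (g3) D55; `K2/STATUS.md` 2026-09-04T03:42–03:54Z).
-/
import Literature.NumberTheory.Automorphic.UnitaryGroupBorelPair              -- ★ `UnitaryGroup.glDiagonal_mem_unitaryGroupOfForm_antidiagonal_iff` (`diag d ∈ U(σ,Φ_N) ↔ σ(d_{rev i}) d_i = 1`); brings ★ `glDiagonal`, `coe_glDiagonal`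
import Literature.NumberTheory.Automorphic.TateLocalZetaShells                -- ★ `normAbs_eq_one_iff_valuation_eq_one` (the unit sphere `{valuation = 1} = {‖·‖ = 1}` of the (FC-D) currency); brings ★ `normAbs`, `normAbs_neg`, `normAbs_le_normAbs_iff`
import Mathlib.Analysis.SpecialFunctions.Pow.NNReal
import HarnessLib

/-!
# h413 ∕ Track B «K2-LIT», (SC-an) line, road «FC» — brick (FC-5): THE DIAGONAL COLLISION MEASURE
# `μ'{a ∈ 𝒪^× : two diagonal entries of diag(a, 1, σ(a)⁻¹)·g are ε-close} ≤ 3·Φ(ε∕ρ)` from the two one-variable fibre bounds of (FC-D)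
# (Harish-Chandra 1970, Part VII §2 p. 69; Rogawski 1990, §1.10 p. 9)

Cell `pub/hodgecm-mathlib`, Track B «K2-LIT», crux H413 = `stmt-HodgeConjecture-24833` (lane `--supports … --as helper`, count-neutral).  THEOREMS ONLY (no `def`,
no `instance`, no `notation`, no named-fact hypothesis, no `sorry`).

WHERE THIS SITS.  Road «FC» ((SC-an) lead K2E3-p14 (g4), MAP v5 (R15-1)) replaces Harish-Chandra's Theorem 14 on the elliptic locus of the model `U = U(σ, Φ₃)(K)` by the
elementary `L²`-statement (FC) «`∫_{C ∩ Φ_β} ∫ β(x g x⁻¹) dx dg < ∞`» (★ (FC-8) `K2E3FinConjRankOne`, K2E3-p23 (g4)), proved by a Cartan∕box count; its step (v) averages the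
near-collision event over the compact one-parameter torus `T' = {t_a = diag(a, 1, σ(a)⁻¹) : a ∈ 𝒪^×} ≤ K₀` with ★ (FC-C) `K2E3CompactSubgroupAveraging` and the probability
`ν := Measure.map (a ↦ t_a) λ×` (CURRENCY RULING (λ×), RULINGS #18 (iv): `λ×` = a Haar measure `μ'` of `Kˣ` on the unit sphere `𝒪^× = {valuation = 1}`, the currency of
★ (FC-D) `K2E3UnitsDigitFibre`).  THIS FILE bounds the fibre «`μ'{a ∈ 𝒪^× : t_a·g has two ε-close diagonal entries}`»: since `diag(t_a g) = (a·g₀₀, g₁₁, σ(a)⁻¹·g₂₂)`, the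
three collision clauses are ONE-VARIABLE events in `a` —
* (0,1) `|a g₀₀ − g₁₁| ≤ ε ⟺ |a − g₁₁∕g₀₀| ≤ ε∕|g₀₀|` (an ADDITIVE fibre `{a : |a − y| ≤ r}`);
* (1,2) `|g₁₁ − σ(a)⁻¹ g₂₂| = |σ(a) g₁₁ − g₂₂| = |a·σ(g₁₁) − σ(g₂₂)|` (`|σ(a)| = 1`, `σ` an isometric involution) — ADDITIVE again, `y = σ(g₂₂)∕σ(g₁₁)`, `r = ε∕|g₁₁|`;
* (0,2) `|a g₀₀ − σ(a)⁻¹ g₂₂| = |a σ(a)·g₀₀ − g₂₂|` — a NORM fibre `{a : |a σ(a) − y| ≤ r}`, `y = g₂₂∕g₀₀`, `r = ε∕|g₀₀|`;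
so that ANY common profile `Φ` for the two fibres on the unit sphere (`μ'{a ∈ 𝒪^× : |a − y| ≤ r} ≤ Φ(r)`, `μ'{a ∈ 𝒪^× : |aσ(a) − y| ≤ r} ≤ Φ(r)`, all `r`, `y`) gives, for
`|g₀₀|, |g₁₁| ≥ ρ > 0`, **`μ'{collision at scale ε} ≤ 3 · Φ(ε∕ρ)`** — by monotonicity and subadditivity of `μ'` alone (no invariance of `μ'` under `σ` or inversion; `Φ` need not
be monotone: each clause sits in a fibre of radius EXACTLY `ε∕ρ`).  §5 instantiates `Φ(r) = max(C,1)·r^κ·μ'(𝒪^×)` from the FROZEN head of (FC-D) (K2E3-p20 (g4), `K2/STATUS.md`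
2026-09-04T03:50:25Z; `r ≤ 1` there, `r > 1` clamped by `μ'{𝒪^× ∩ …} ≤ μ'(𝒪^×)`), taken as the hypothesis `hD` (its statement at the ambient `K, σ, μ'`, token for token) until
the (FC-D) file lands — then `hD := K2E3UnitsDigitFibre.unitsDigitFibre σ hσ hσn μ'`.
CONTENTS.  §1 absolute values (`ValuativeRel`∕`normAbs` currency of (FC-D); `σ` an isometric involution `hσ`, `hσn`): `normAbs_sub_inv_map_mul_eq` (`‖u‖ = 1 ⇒ |y − σ(u)⁻¹ z| =
|u σ(y) − σ(z)|`), `normAbs_mul_sub_inv_map_mul_eq` (`|u x − σ(u)⁻¹ z| = |u σ(u) x − z|`), `normAbs_sub_div_le_div` (rescaling).  §2 the MODEL-AGNOSTIC PROFILE LEMMA (any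
type `A`, measure `ν`, `ι : A → Kˣ`, profile `Φ : ℝ≥0 → ℝ≥0∞` dominating the two fibres on the unit sphere `{valuation (ι a) = 1}`): `measure_collision01_le`∕`12`∕`02` and
`measure_diagCollision_le_of_profile` (`≤ 3·Φ(ε∕ρ)`).  §3 the torus element `t_u = glDiagonal 3 K ![u, 1, (σ u)⁻¹]` (`torusOne_mem_unitaryGroupOfForm`, the diagonal of
`t_u · g`, `setOf_exists_collision_subset`).  §4 consumer forms `measure_diagCollision_matrix_le_of_profile`, `measure_diagCollision_unitary_le_of_profile` (product in `↥U`); from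
the `Valued K ℤᵐ⁰` model frame 𝔉 of the line, `hσn` is ★ `K2E3SplitTorusTwistModuleBound.normAbs_map_eq σ hσv` and the lower bounds `ρ ≤ |g_ii|` come from `|ϖ^M g_ii⁻¹| ≤ 1` by
★ (M5e-2) `K2E3SplitTorusDepthFromDiscriminant.pow_normAbs_le_normAbs_of_v_pow_mul_inv_le_one`.  §5 `measure_diagCollision_unitary_le_of_unitsDigitFibre`: over (FC-D)'s frozen head,
`∃ κ > 0, ∃ C ≠ ⊤, ∀ ρ > 0, ∀ ε, ∀ g ∈ U` with `ρ ≤ |g₀₀|, |g₁₁|`: `μ'{a ∈ 𝒪^× : ∃ i ≠ j, |(t_a g)_ii − (t_a g)_jj| ≤ ε} ≤ C·(ε∕ρ)^κ·μ'(𝒪^×)` (`C = 3·max(C_D, 1)`, same `κ`).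

HONEST LABEL: HC_CM is proved only modulo the 7 printed citations (2 remaining named inputs: hLiu418 = `stmt-HodgeConjecture-24832`, h413 =
`stmt-HodgeConjecture-24833`) until rung 0 closes; this file is a count-neutral helper (valuation bookkeeping + a union bound; nothing printed is asserted as a fact).

## References
* [HarishChandra1970] Harish-Chandra (notes by G. van Dijk), *Harmonic Analysis on Reductive p-adic Groups*, LNM 162 (1970), Part VII §2 p. 69; Part VI §8 Thm 14 p. 60.
* [Rogawski1990] J. D. Rogawski, *Automorphic Representations of Unitary Groups in Three Variables*, Ann. of Math. Stud. 123 (1990), §1.10 p. 9 (`M = {d(α, β, ᾱ⁻¹)}`).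
* [Serre1979] J.-P. Serre, *Local Fields*, GTM 67 (1979), Ch. II §1 (the normalised absolute value of a local field).
-/

set_option autoImplicit false
set_option linter.dupNamespace false  -- the mandated namespace repeats the single-problem summit's segment (`HodgeConjecture.HodgeConjecture`)

noncomputable section

open MeasureTheory Set ValuativeRel Literature.NumberTheory.Automorphic Literature.NumberTheory.Automorphic.UnitaryGroup
open Literature.NumberTheory.GaloisRepresentations Literature.NumberTheory.GaloisRepresentations.IsNonarchimedeanLocalField
open scoped NNReal ENNReal MatrixGroups

namespace Summit.HodgeConjecture.HodgeConjecture.Cruxes.H413.K2E3DiagonalCollisionMeasure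

/-! ## §1 Absolute values: `σ` an isometric involution, `‖u‖ = 1` (the `ValuativeRel`∕`normAbs` currency of (FC-D)) -/

section Abs
variable {K : Type*} [Field K] [ValuativeRel K] [TopologicalSpace K] [IsNonarchimedeanLocalField K]

/-- The unit sphere of (FC-D): `valuation K u = 1 ⇒ ‖u‖ = 1` (★ `normAbs_eq_one_iff_valuation_eq_one`). [cite: Serre1979, Ch. II §1] -/
theorem normAbs_eq_one_of_valuation_eq_one {u : K} (hu : valuation K u = 1) : normAbs K u = 1 :=
  normAbs_eq_one_iff_valuation_eq_one.2 hu

variable (σ : K →+* K) (hσ : ∀ x, σ (σ x) = x) (hσn : ∀ x, normAbs K (σ x) = normAbs K x)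

include hσn in
/-- For `‖u‖ = 1`: `‖σ u‖ = 1`. [cite: HarishChandra1970, Part VII §2 p. 69] -/
theorem normAbs_map_eq_one {u : K} (hu : normAbs K u = 1) : normAbs K (σ u) = 1 := by
  rw [hσn, hu]

include hσn in
/-- For `‖u‖ = 1`: `σ u ≠ 0`. [cite: HarishChandra1970, Part VII §2 p. 69] -/
theorem map_ne_zero_of_normAbs_eq_one {u : K} (hu : normAbs K u = 1) : σ u ≠ 0 := by
  intro h
  have h1 := normAbs_map_eq_one σ hσn hu
  rw [h, map_zero] at h1
  exact zero_ne_one h1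

include hσ hσn in
/-- **THE (1,2)-CLAUSE IS ADDITIVE**: for `‖u‖ = 1`, `|y − σ(u)⁻¹ z| = |u·σ(y) − σ(z)|` (`= |σ(u)|⁻¹·|σ(u) y − z| = |σ(σ(u) y − z)|`, `σ` an isometric involution).
[cite: HarishChandra1970, Part VII §2 p. 69] [cite: Rogawski1990, §1.10 p. 9] -/
theorem normAbs_sub_inv_map_mul_eq {u : K} (hu : normAbs K u = 1) (y z : K) :
    normAbs K (y - (σ u)⁻¹ * z) = normAbs K (u * σ y - σ z) := by
  have hσu : σ u ≠ 0 := map_ne_zero_of_normAbs_eq_one σ hσn hu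
  have h1 : y - (σ u)⁻¹ * z = (σ u)⁻¹ * (σ u * y - z) := by field_simp
  have h2 : u * σ y - σ z = σ (σ u * y - z) := by rw [map_sub, map_mul, hσ]
  rw [h1, map_mul, map_inv₀, normAbs_map_eq_one σ hσn hu, inv_one, one_mul, h2, hσn]

include hσn in
/-- **THE (0,2)-CLAUSE IS A NORM EVENT**: for `‖u‖ = 1`, `|u x − σ(u)⁻¹ z| = |u σ(u)·x − z|` (`= |σ(u)|⁻¹ · |σ(u) u x − z|`).
[cite: HarishChandra1970, Part VII §2 p. 69] [cite: Rogawski1990, §1.10 p. 9] -/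
theorem normAbs_mul_sub_inv_map_mul_eq {u : K} (hu : normAbs K u = 1) (x z : K) :
    normAbs K (u * x - (σ u)⁻¹ * z) = normAbs K (u * σ u * x - z) := by
  have hσu : σ u ≠ 0 := map_ne_zero_of_normAbs_eq_one σ hσn hu
  have h1 : u * x - (σ u)⁻¹ * z = (σ u)⁻¹ * (u * σ u * x - z) := by field_simp
  rw [h1, map_mul, map_inv₀, normAbs_map_eq_one σ hσn hu, inv_one, one_mul]

/-- **SCALING**: `|w x − y| ≤ ε` with `0 < ρ ≤ |x|` gives `|w − y∕x| ≤ ε∕ρ` (`w − y∕x = (w x − y)∕x`). [cite: Serre1979, Ch. II §1] -/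
theorem normAbs_sub_div_le_div {x : K} {ρ : ℝ≥0} (hρ : 0 < ρ) (hx : ρ ≤ normAbs K x) {w y : K} {ε : ℝ≥0}
    (h : normAbs K (w * x - y) ≤ ε) : normAbs K (w - y / x) ≤ ε / ρ := by
  have hx0 : normAbs K x ≠ 0 := (hρ.trans_le hx).ne'
  have hxK : x ≠ 0 := fun h0 => hx0 (by rw [h0, map_zero])
  have h1 : w - y / x = (w * x - y) * x⁻¹ := by field_simp
  rw [h1, map_mul, map_inv₀, div_eq_mul_inv]
  exact mul_le_mul' h (inv_anti₀ hρ hx)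

/-- `|x − y| = |y − x|`. [cite: Serre1979, Ch. II §1] -/
theorem normAbs_sub_comm (x y : K) : normAbs K (x - y) = normAbs K (y - x) := by
  rw [← normAbs_neg, neg_sub]

end Abs

/-! ## §2 The model-agnostic profile lemma on the unit sphere `{valuation (ι a) = 1}` -/

section Profile
variable {K : Type*} [Field K] [ValuativeRel K] [TopologicalSpace K] [IsNonarchimedeanLocalField K]
  (σ : K →+* K) (hσ : ∀ x, σ (σ x) = x) (hσn : ∀ x, normAbs K (σ x) = normAbs K x)
  {A : Type*} [MeasurableSpace A] (ν : Measure A) (ι : A → Kˣ) (Φ : ℝ≥0 → ℝ≥0∞)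
  (hadd : ∀ (r : ℝ≥0) (y : K), ν {a | valuation K (ι a : K) = 1 ∧ normAbs K ((ι a : K) - y) ≤ r} ≤ Φ r)
  (hnorm : ∀ (r : ℝ≥0) (y : K), ν {a | valuation K (ι a : K) = 1 ∧ normAbs K ((ι a : K) * σ (ι a : K) - y) ≤ r} ≤ Φ r)
  {ρ : ℝ≥0} (hρ : 0 < ρ)

include hadd hρ in
/-- **THE (0,1)-CLAUSE**: `ρ ≤ |x| ⇒ ν{a ∈ 𝒪^× : |ι(a)·x − y| ≤ ε} ≤ Φ(ε∕ρ)` (the event lies in the additive fibre `{|ι a − y∕x| ≤ ε∕ρ}`).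
[cite: HarishChandra1970, Part VII §2 p. 69] [cite: Rogawski1990, §1.10 p. 9] -/
theorem measure_collision01_le {x : K} (hx : ρ ≤ normAbs K x) (y : K) (ε : ℝ≥0) :
    ν {a | valuation K (ι a : K) = 1 ∧ normAbs K ((ι a : K) * x - y) ≤ ε} ≤ Φ (ε / ρ) := by
  refine (measure_mono (fun a ha => ?_)).trans (hadd (ε / ρ) (y / x))
  exact ⟨ha.1, normAbs_sub_div_le_div hρ hx ha.2⟩

include hσ hσn hadd hρ in
/-- **THE (1,2)-CLAUSE**: `ρ ≤ |y| ⇒ ν{a ∈ 𝒪^× : |y − σ(ι a)⁻¹·z| ≤ ε} ≤ Φ(ε∕ρ)` (by `normAbs_sub_inv_map_mul_eq` the event is `{|ι a · σ(y) − σ(z)| ≤ ε}`, an additive fibre of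
radius `ε∕|σ y| = ε∕|y|`). [cite: HarishChandra1970, Part VII §2 p. 69] [cite: Rogawski1990, §1.10 p. 9] -/
theorem measure_collision12_le {y : K} (hy : ρ ≤ normAbs K y) (z : K) (ε : ℝ≥0) :
    ν {a | valuation K (ι a : K) = 1 ∧ normAbs K (y - (σ (ι a : K))⁻¹ * z) ≤ ε} ≤ Φ (ε / ρ) := by
  have hy' : ρ ≤ normAbs K (σ y) := by rwa [hσn]
  refine (measure_mono (fun a ha => ?_)).trans (hadd (ε / ρ) (σ z / σ y))
  have ha' : normAbs K ((ι a : K) * σ y - σ z) ≤ ε := by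
    rw [← normAbs_sub_inv_map_mul_eq σ hσ hσn (normAbs_eq_one_of_valuation_eq_one ha.1) y z]; exact ha.2
  exact ⟨ha.1, normAbs_sub_div_le_div hρ hy' ha'⟩

include hσn hnorm hρ in
/-- **THE (0,2)-CLAUSE**: `ρ ≤ |x| ⇒ ν{a ∈ 𝒪^× : |ι(a)·x − σ(ι a)⁻¹·z| ≤ ε} ≤ Φ(ε∕ρ)` (by `normAbs_mul_sub_inv_map_mul_eq` the event is `{|ι a σ(ι a)·x − z| ≤ ε}`, a norm
fibre of radius `ε∕|x|`). [cite: HarishChandra1970, Part VII §2 p. 69] [cite: Rogawski1990, §1.10 p. 9] -/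
theorem measure_collision02_le {x : K} (hx : ρ ≤ normAbs K x) (z : K) (ε : ℝ≥0) :
    ν {a | valuation K (ι a : K) = 1 ∧ normAbs K ((ι a : K) * x - (σ (ι a : K))⁻¹ * z) ≤ ε} ≤ Φ (ε / ρ) := by
  refine (measure_mono (fun a ha => ?_)).trans (hnorm (ε / ρ) (z / x))
  have ha' : normAbs K ((ι a : K) * σ (ι a : K) * x - z) ≤ ε := by
    rw [← normAbs_mul_sub_inv_map_mul_eq σ hσn (normAbs_eq_one_of_valuation_eq_one ha.1) x z]; exact ha.2
  exact ⟨ha.1, normAbs_sub_div_le_div hρ hx ha'⟩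

include hσ hσn hadd hnorm hρ in
/-- **THE PROFILE LEMMA (three clauses)**: for `0 < ρ ≤ |x|, |y|` and every `ε`,
`ν{a ∈ 𝒪^× : |ι a·x − y| ≤ ε ∨ |y − σ(ι a)⁻¹ z| ≤ ε ∨ |ι a·x − σ(ι a)⁻¹ z| ≤ ε} ≤ 3·Φ(ε∕ρ)` — the three diagonal collisions of `diag(ι a, 1, σ(ι a)⁻¹)·g` with
`(g₀₀, g₁₁, g₂₂) = (x, y, z)`; union bound over the three clauses. [cite: HarishChandra1970, Part VII §2 p. 69] [cite: Rogawski1990, §1.10 p. 9] -/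
theorem measure_diagCollision_le_of_profile {x y : K} (hx : ρ ≤ normAbs K x) (hy : ρ ≤ normAbs K y) (z : K) (ε : ℝ≥0) :
    ν {a | valuation K (ι a : K) = 1 ∧ (normAbs K ((ι a : K) * x - y) ≤ ε ∨ normAbs K (y - (σ (ι a : K))⁻¹ * z) ≤ ε ∨
        normAbs K ((ι a : K) * x - (σ (ι a : K))⁻¹ * z) ≤ ε)} ≤ 3 * Φ (ε / ρ) := by
  have hsub : {a | valuation K (ι a : K) = 1 ∧ (normAbs K ((ι a : K) * x - y) ≤ ε ∨ normAbs K (y - (σ (ι a : K))⁻¹ * z) ≤ ε ∨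
        normAbs K ((ι a : K) * x - (σ (ι a : K))⁻¹ * z) ≤ ε)} ⊆
      {a | valuation K (ι a : K) = 1 ∧ normAbs K ((ι a : K) * x - y) ≤ ε} ∪
        ({a | valuation K (ι a : K) = 1 ∧ normAbs K (y - (σ (ι a : K))⁻¹ * z) ≤ ε} ∪
          {a | valuation K (ι a : K) = 1 ∧ normAbs K ((ι a : K) * x - (σ (ι a : K))⁻¹ * z) ≤ ε}) := by
    rintro a ⟨h1, h2 | h2 | h2⟩
    · exact Or.inl ⟨h1, h2⟩
    · exact Or.inr (Or.inl ⟨h1, h2⟩)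
    · exact Or.inr (Or.inr ⟨h1, h2⟩)
  calc ν {a | valuation K (ι a : K) = 1 ∧ (normAbs K ((ι a : K) * x - y) ≤ ε ∨ normAbs K (y - (σ (ι a : K))⁻¹ * z) ≤ ε ∨
          normAbs K ((ι a : K) * x - (σ (ι a : K))⁻¹ * z) ≤ ε)}
        ≤ ν ({a | valuation K (ι a : K) = 1 ∧ normAbs K ((ι a : K) * x - y) ≤ ε} ∪
            ({a | valuation K (ι a : K) = 1 ∧ normAbs K (y - (σ (ι a : K))⁻¹ * z) ≤ ε} ∪
              {a | valuation K (ι a : K) = 1 ∧ normAbs K ((ι a : K) * x - (σ (ι a : K))⁻¹ * z) ≤ ε})) := measure_mono hsub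
    _ ≤ ν {a | valuation K (ι a : K) = 1 ∧ normAbs K ((ι a : K) * x - y) ≤ ε} +
          (ν {a | valuation K (ι a : K) = 1 ∧ normAbs K (y - (σ (ι a : K))⁻¹ * z) ≤ ε} +
            ν {a | valuation K (ι a : K) = 1 ∧ normAbs K ((ι a : K) * x - (σ (ι a : K))⁻¹ * z) ≤ ε}) :=
          (measure_union_le _ _).trans (add_le_add le_rfl (measure_union_le _ _))
    _ ≤ Φ (ε / ρ) + (Φ (ε / ρ) + Φ (ε / ρ)) :=
          add_le_add (measure_collision01_le ν ι Φ hadd hρ hx y ε)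
            (add_le_add (measure_collision12_le σ hσ hσn ν ι Φ hadd hρ hy z ε) (measure_collision02_le σ hσn ν ι Φ hnorm hρ hx z ε))
    _ = 3 * Φ (ε / ρ) := by ring

end Profile

/-! ## §3 The torus element `t_u = diag(u, 1, σ(u)⁻¹)` of `U(σ, Φ₃)(K)` and the diagonal of `t_u · g` -/

section Torus
variable {K : Type*} [Field K] (σ : K →+* K)

/-- **`t_u = diag(u, 1, σ(u)⁻¹) ∈ U(σ, Φ₃)(K)`** for `σ` an involution (★ `glDiagonal_mem_unitaryGroupOfForm_antidiagonal_iff`: `σ(d_{2−i}) d_i = 1`).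
[cite: Rogawski1990, §1.10 p. 9] -/
theorem torusOne_mem_unitaryGroupOfForm (hσ : ∀ x, σ (σ x) = x) (u : Kˣ) :
    glDiagonal 3 K ![u, 1, (Units.map (σ : K →* K) u)⁻¹] ∈ unitaryGroupOfForm σ ((StdForm.antidiagonal 3).over K) := by
  rw [glDiagonal_mem_unitaryGroupOfForm_antidiagonal_iff]
  intro i
  fin_cases i
  · show σ (((Units.map (σ : K →* K) u)⁻¹ : Kˣ) : K) * (u : K) = 1
    rw [Units.val_inv_eq_inv_val, Units.coe_map, MonoidHom.coe_coe, map_inv₀, hσ, inv_mul_cancel₀ u.ne_zero]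
  · show σ ((1 : Kˣ) : K) * ((1 : Kˣ) : K) = 1
    rw [Units.val_one, map_one, mul_one]
  · show σ (u : K) * (((Units.map (σ : K →* K) u)⁻¹ : Kˣ) : K) = 1
    rw [Units.val_inv_eq_inv_val, Units.coe_map, MonoidHom.coe_coe, mul_inv_cancel₀]
    intro h
    exact u.ne_zero (by rw [← hσ (u : K), h, map_zero])

/-- The `(0,0)` entry of `t_u · g` is `u · g₀₀`. [cite: Rogawski1990, §1.10 p. 9] -/
theorem glDiagonal_torusOne_mul_apply_zero (u : Kˣ) (g : Matrix (Fin 3) (Fin 3) K) :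
    ((glDiagonal 3 K ![u, 1, (Units.map (σ : K →* K) u)⁻¹] : Matrix (Fin 3) (Fin 3) K) * g) 0 0 = (u : K) * g 0 0 := by
  rw [coe_glDiagonal, Matrix.diagonal_mul]
  rfl

/-- The `(1,1)` entry of `t_u · g` is `g₁₁`. [cite: Rogawski1990, §1.10 p. 9] -/
theorem glDiagonal_torusOne_mul_apply_one (u : Kˣ) (g : Matrix (Fin 3) (Fin 3) K) :
    ((glDiagonal 3 K ![u, 1, (Units.map (σ : K →* K) u)⁻¹] : Matrix (Fin 3) (Fin 3) K) * g) 1 1 = g 1 1 := by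
  rw [coe_glDiagonal, Matrix.diagonal_mul]
  show ((1 : Kˣ) : K) * g 1 1 = g 1 1
  rw [Units.val_one, one_mul]

/-- The `(2,2)` entry of `t_u · g` is `σ(u)⁻¹ · g₂₂`. [cite: Rogawski1990, §1.10 p. 9] -/
theorem glDiagonal_torusOne_mul_apply_two (u : Kˣ) (g : Matrix (Fin 3) (Fin 3) K) :
    ((glDiagonal 3 K ![u, 1, (Units.map (σ : K →* K) u)⁻¹] : Matrix (Fin 3) (Fin 3) K) * g) 2 2 = (σ u)⁻¹ * g 2 2 := by
  rw [coe_glDiagonal, Matrix.diagonal_mul]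
  show (((Units.map (σ : K →* K) u)⁻¹ : Kˣ) : K) * g 2 2 = (σ u)⁻¹ * g 2 2
  rw [Units.val_inv_eq_inv_val, Units.coe_map, MonoidHom.coe_coe]

end Torus

section TorusAbs
variable {K : Type*} [Field K] [ValuativeRel K] [TopologicalSpace K] [IsNonarchimedeanLocalField K] (σ : K →+* K) {A : Type*} (ι : A → Kˣ)

/-- **THE `∃ i ≠ j` COLLISION EVENT IS THE THREE-CLAUSE EVENT** (on the unit sphere): for `g : Matrix (Fin 3) (Fin 3) K` with diagonal `(x, y, z)`,
`{a ∈ 𝒪^× : ∃ i ≠ j, |(t_{ι a} g)_ii − (t_{ι a} g)_jj| ≤ ε} ⊆ {a ∈ 𝒪^× : |ι a·x − y| ≤ ε ∨ |y − σ(ι a)⁻¹ z| ≤ ε ∨ |ι a·x − σ(ι a)⁻¹ z| ≤ ε}` (the six ordered pairs;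
`|p − q| = |q − p|`). [cite: Rogawski1990, §1.10 p. 9] -/
theorem setOf_exists_collision_subset (g : Matrix (Fin 3) (Fin 3) K) (ε : ℝ≥0) :
    {a | valuation K (ι a : K) = 1 ∧ ∃ i j : Fin 3, i ≠ j ∧
        normAbs K (((glDiagonal 3 K ![ι a, 1, (Units.map (σ : K →* K) (ι a))⁻¹] : Matrix (Fin 3) (Fin 3) K) * g) i i -
          ((glDiagonal 3 K ![ι a, 1, (Units.map (σ : K →* K) (ι a))⁻¹] : Matrix (Fin 3) (Fin 3) K) * g) j j) ≤ ε} ⊆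
      {a | valuation K (ι a : K) = 1 ∧ (normAbs K ((ι a : K) * g 0 0 - g 1 1) ≤ ε ∨ normAbs K (g 1 1 - (σ (ι a : K))⁻¹ * g 2 2) ≤ ε ∨
        normAbs K ((ι a : K) * g 0 0 - (σ (ι a : K))⁻¹ * g 2 2) ≤ ε)} := by
  rintro a ⟨hv, i, j, hij, h⟩
  refine ⟨hv, ?_⟩
  have h3 : ∀ k : Fin 3, k = 0 ∨ k = 1 ∨ k = 2 := by decide
  rcases h3 i with rfl | rfl | rfl <;> rcases h3 j with rfl | rfl | rfl
  · exact absurd rfl hij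
  · left
    rwa [glDiagonal_torusOne_mul_apply_zero, glDiagonal_torusOne_mul_apply_one] at h
  · right; right
    rwa [glDiagonal_torusOne_mul_apply_zero, glDiagonal_torusOne_mul_apply_two] at h
  · left
    rwa [glDiagonal_torusOne_mul_apply_one, glDiagonal_torusOne_mul_apply_zero, normAbs_sub_comm] at h
  · exact absurd rfl hij
  · right; left
    rwa [glDiagonal_torusOne_mul_apply_one, glDiagonal_torusOne_mul_apply_two] at h
  · right; right
    rwa [glDiagonal_torusOne_mul_apply_two, glDiagonal_torusOne_mul_apply_zero, normAbs_sub_comm] at h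
  · right; left
    rwa [glDiagonal_torusOne_mul_apply_two, glDiagonal_torusOne_mul_apply_one, normAbs_sub_comm] at h
  · exact absurd rfl hij

end TorusAbs

/-! ## §4 The consumer forms: matrix currency and `↥U(σ, Φ₃)` currency -/

section Consumer
variable {K : Type*} [Field K] [ValuativeRel K] [TopologicalSpace K] [IsNonarchimedeanLocalField K]
  (σ : K →+* K) (hσ : ∀ x, σ (σ x) = x) (hσn : ∀ x, normAbs K (σ x) = normAbs K x)
  {A : Type*} [MeasurableSpace A] (ν : Measure A) (ι : A → Kˣ) (Φ : ℝ≥0 → ℝ≥0∞)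
  (hadd : ∀ (r : ℝ≥0) (y : K), ν {a | valuation K (ι a : K) = 1 ∧ normAbs K ((ι a : K) - y) ≤ r} ≤ Φ r)
  (hnorm : ∀ (r : ℝ≥0) (y : K), ν {a | valuation K (ι a : K) = 1 ∧ normAbs K ((ι a : K) * σ (ι a : K) - y) ≤ r} ≤ Φ r)

include hσ hσn hadd hnorm in
/-- **(FC-5), MATRIX CURRENCY**: for `g : Matrix (Fin 3) (Fin 3) K` with `0 < ρ ≤ |g₀₀|, |g₁₁|` and every `ε`,
`ν{a ∈ 𝒪^× : ∃ i ≠ j, |(t_{ι a}·g)_ii − (t_{ι a}·g)_jj| ≤ ε} ≤ 3·Φ(ε∕ρ)`, `t_u = diag(u, 1, σ(u)⁻¹)`. [cite: HarishChandra1970, Part VII §2 p. 69] [cite: Rogawski1990, §1.10 p. 9] -/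
theorem measure_diagCollision_matrix_le_of_profile {ρ : ℝ≥0} (hρ : 0 < ρ) (g : Matrix (Fin 3) (Fin 3) K)
    (hg0 : ρ ≤ normAbs K (g 0 0)) (hg1 : ρ ≤ normAbs K (g 1 1)) (ε : ℝ≥0) :
    ν {a | valuation K (ι a : K) = 1 ∧ ∃ i j : Fin 3, i ≠ j ∧
        normAbs K (((glDiagonal 3 K ![ι a, 1, (Units.map (σ : K →* K) (ι a))⁻¹] : Matrix (Fin 3) (Fin 3) K) * g) i i -
          ((glDiagonal 3 K ![ι a, 1, (Units.map (σ : K →* K) (ι a))⁻¹] : Matrix (Fin 3) (Fin 3) K) * g) j j) ≤ ε} ≤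
      3 * Φ (ε / ρ) :=
  (measure_mono (setOf_exists_collision_subset σ ι g ε)).trans
    (measure_diagCollision_le_of_profile σ hσ hσn ν ι Φ hadd hnorm hρ hg0 hg1 (g 2 2) ε)

include hσ hσn hadd hnorm in
/-- **(FC-5), `↥U(σ, Φ₃)` CURRENCY** (the form (FC-8) averages with ★ (FC-C)): for `g ∈ U(σ, Φ₃)(K)` whose `(0,0)` and `(1,1)` entries have `|·| ≥ ρ > 0`, the torus
elements `t_{ι a} = ⟨diag(ι a, 1, σ(ι a)⁻¹), _⟩ ∈ U` satisfy `ν{a ∈ 𝒪^× : ∃ i ≠ j, |(t_{ι a} * g)_ii − (t_{ι a} * g)_jj| ≤ ε} ≤ 3·Φ(ε∕ρ)` (product in `↥U`).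
[cite: HarishChandra1970, Part VII §2 p. 69] [cite: Rogawski1990, §1.10 p. 9] -/
theorem measure_diagCollision_unitary_le_of_profile {ρ : ℝ≥0} (hρ : 0 < ρ)
    (g : ↥(unitaryGroupOfForm σ ((StdForm.antidiagonal 3).over K)))
    (hg0 : ρ ≤ normAbs K (((g : GL (Fin 3) K) : Matrix (Fin 3) (Fin 3) K) 0 0))
    (hg1 : ρ ≤ normAbs K (((g : GL (Fin 3) K) : Matrix (Fin 3) (Fin 3) K) 1 1)) (ε : ℝ≥0) :
    ν {a | valuation K (ι a : K) = 1 ∧ ∃ i j : Fin 3, i ≠ j ∧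
        normAbs K
          (((((⟨glDiagonal 3 K ![ι a, 1, (Units.map (σ : K →* K) (ι a))⁻¹], torusOne_mem_unitaryGroupOfForm σ hσ (ι a)⟩ :
                ↥(unitaryGroupOfForm σ ((StdForm.antidiagonal 3).over K))) * g :
                ↥(unitaryGroupOfForm σ ((StdForm.antidiagonal 3).over K))) : GL (Fin 3) K) : Matrix (Fin 3) (Fin 3) K) i i -
           ((((⟨glDiagonal 3 K ![ι a, 1, (Units.map (σ : K →* K) (ι a))⁻¹], torusOne_mem_unitaryGroupOfForm σ hσ (ι a)⟩ :
                ↥(unitaryGroupOfForm σ ((StdForm.antidiagonal 3).over K))) * g :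
                ↥(unitaryGroupOfForm σ ((StdForm.antidiagonal 3).over K))) : GL (Fin 3) K) : Matrix (Fin 3) (Fin 3) K) j j) ≤ ε} ≤
      3 * Φ (ε / ρ) := by
  have h := measure_diagCollision_matrix_le_of_profile σ hσ hσn ν ι Φ hadd hnorm hρ ((g : GL (Fin 3) K) : Matrix (Fin 3) (Fin 3) K) hg0 hg1 ε
  simpa only [Subgroup.coe_mul, Units.val_mul] using h

end Consumer

/-! ## §5 Over (FC-D)'s frozen head: `Φ(r) = max(C, 1) · r^κ · μ'(𝒪^×)` on `μ' : Measure Kˣ` -/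

section UnitsDigitFibre
variable {K : Type*} [Field K] [ValuativeRel K] [TopologicalSpace K] [IsNonarchimedeanLocalField K]
  (σ : K →+* K) (hσ : ∀ x, σ (σ x) = x) (hσn : ∀ x, normAbs K (σ x) = normAbs K x)
  [MeasurableSpace Kˣ] (μ' : Measure Kˣ)

omit [TopologicalSpace K] [IsNonarchimedeanLocalField K] in
/-- **THE PROFILE OF (FC-D), CLAMPED**: from (FC-D)'s bound `μ'{a ∈ 𝒪^× : …} ≤ C r^κ μ'(𝒪^×)` for `r ≤ 1` to the profile `Φ(r) = max(C,1)·r^κ·μ'(𝒪^×)` for ALL `r`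
(`r > 1`: `μ'{𝒪^× ∩ …} ≤ μ'(𝒪^×) ≤ max(C,1)·r^κ·μ'(𝒪^×)` as `r^κ ≥ 1`). [cite: Serre1979, Ch. II §1] -/
theorem measure_sep_le_clampedProfile {κ : ℝ} (hκ : 0 < κ) {C : ℝ≥0∞} {P : ℝ≥0 → Kˣ → Prop}
    (h : ∀ r : ℝ≥0, r ≤ 1 → μ' {a : Kˣ | valuation K (a : K) = 1 ∧ P r a} ≤ C * (r : ℝ≥0∞) ^ κ * μ' {a : Kˣ | valuation K (a : K) = 1})
    (r : ℝ≥0) : μ' {a : Kˣ | valuation K (a : K) = 1 ∧ P r a} ≤ max C 1 * (r : ℝ≥0∞) ^ κ * μ' {a : Kˣ | valuation K (a : K) = 1} := by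
  by_cases hr : r ≤ 1
  · exact (h r hr).trans (mul_le_mul' (mul_le_mul' (le_max_left _ _) le_rfl) le_rfl)
  · have hr1 : (1 : ℝ≥0∞) ≤ (r : ℝ≥0∞) := by exact_mod_cast (lt_of_not_ge hr).le
    calc μ' {a : Kˣ | valuation K (a : K) = 1 ∧ P r a} ≤ μ' {a : Kˣ | valuation K (a : K) = 1} := measure_mono (fun a ha => ha.1)
      _ = 1 * 1 * μ' {a : Kˣ | valuation K (a : K) = 1} := by rw [one_mul, one_mul]
      _ ≤ max C 1 * (r : ℝ≥0∞) ^ κ * μ' {a : Kˣ | valuation K (a : K) = 1} :=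
          mul_le_mul' (mul_le_mul' (le_max_right _ _) (ENNReal.one_le_rpow hr1 hκ)) le_rfl

include hσ hσn in
/-- **(FC-5) OVER (FC-D)** — the form (FC-8) consumes: given (FC-D)'s conclusion `hD` for the ambient `K, σ, μ'` (K2E3-p20 (g4)'s FROZEN head, `K2/STATUS.md`
2026-09-04T03:50:25Z, token for token; `hD := K2E3UnitsDigitFibre.unitsDigitFibre σ hσ hσn μ'` once ★), there are `κ > 0` and `C ≠ ⊤` (namely `3·max(C_D, 1)`, same `κ`)
such that for every `ρ > 0`, every `ε`, and every `g ∈ U(σ, Φ₃)(K)` with `ρ ≤ |g₀₀|, |g₁₁|`: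
`μ'{a ∈ 𝒪^× : ∃ i ≠ j, |(t_a * g)_ii − (t_a * g)_jj| ≤ ε} ≤ C · (ε∕ρ)^κ · μ'(𝒪^×)`, `t_a = ⟨diag(a, 1, σ(a)⁻¹), _⟩ ∈ U`, `𝒪^× = {a : Kˣ | valuation K a = 1}`.
[cite: HarishChandra1970, Part VII §2 p. 69] [cite: Rogawski1990, §1.10 p. 9] -/
theorem measure_diagCollision_unitary_le_of_unitsDigitFibre
    (hD : ∃ κ : ℝ, 0 < κ ∧ ∃ C : ℝ≥0∞, C ≠ ⊤ ∧ ∀ r : ℝ≥0, r ≤ 1 → ∀ x y : K, normAbs K x = 1 →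
      μ' {a : Kˣ | valuation K ↑a = 1 ∧ normAbs K (↑a * x - y) ≤ r} ≤ C * (r : ℝ≥0∞) ^ κ * μ' {a : Kˣ | valuation K ↑a = 1} ∧
      μ' {a : Kˣ | valuation K ↑a = 1 ∧ normAbs K (↑a * σ ↑a * x - y) ≤ r} ≤ C * (r : ℝ≥0∞) ^ κ * μ' {a : Kˣ | valuation K ↑a = 1}) :
    ∃ κ : ℝ, 0 < κ ∧ ∃ C : ℝ≥0∞, C ≠ ⊤ ∧ ∀ ρ : ℝ≥0, 0 < ρ → ∀ ε : ℝ≥0,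
      ∀ g : ↥(unitaryGroupOfForm σ ((StdForm.antidiagonal 3).over K)),
        ρ ≤ normAbs K (((g : GL (Fin 3) K) : Matrix (Fin 3) (Fin 3) K) 0 0) → ρ ≤ normAbs K (((g : GL (Fin 3) K) : Matrix (Fin 3) (Fin 3) K) 1 1) →
        μ' {a : Kˣ | valuation K ↑a = 1 ∧ ∃ i j : Fin 3, i ≠ j ∧
            normAbs K
              (((((⟨glDiagonal 3 K ![a, 1, (Units.map (σ : K →* K) a)⁻¹], torusOne_mem_unitaryGroupOfForm σ hσ a⟩ :
                    ↥(unitaryGroupOfForm σ ((StdForm.antidiagonal 3).over K))) * g :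
                    ↥(unitaryGroupOfForm σ ((StdForm.antidiagonal 3).over K))) : GL (Fin 3) K) : Matrix (Fin 3) (Fin 3) K) i i -
               ((((⟨glDiagonal 3 K ![a, 1, (Units.map (σ : K →* K) a)⁻¹], torusOne_mem_unitaryGroupOfForm σ hσ a⟩ :
                    ↥(unitaryGroupOfForm σ ((StdForm.antidiagonal 3).over K))) * g :
                    ↥(unitaryGroupOfForm σ ((StdForm.antidiagonal 3).over K))) : GL (Fin 3) K) : Matrix (Fin 3) (Fin 3) K) j j) ≤ ε} ≤
          C * ((ε / ρ : ℝ≥0) : ℝ≥0∞) ^ κ * μ' {a : Kˣ | valuation K ↑a = 1} := by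
  obtain ⟨κ, hκ, C, hC, hD⟩ := hD
  refine ⟨κ, hκ, 3 * max C 1, ?_, fun ρ hρ ε g hg0 hg1 => ?_⟩
  · exact ENNReal.mul_ne_top (by norm_num) (by simp [hC])
  -- the clamped profile `Φ(r) = max(C,1) r^κ μ'(𝒪^×)` dominates both fibres at `x = 1` for every `r`
  have hadd : ∀ (r : ℝ≥0) (y : K), μ' {a : Kˣ | valuation K ((id a : Kˣ) : K) = 1 ∧ normAbs K (((id a : Kˣ) : K) - y) ≤ r} ≤
      max C 1 * (r : ℝ≥0∞) ^ κ * μ' {a : Kˣ | valuation K (a : K) = 1} := by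
    intro r y
    have h := measure_sep_le_clampedProfile μ' hκ (P := fun r a => normAbs K ((a : K) - y) ≤ r)
      (fun r hr => by simpa only [mul_one] using ((hD r hr 1 y (map_one _)).1)) r
    simpa only [id] using h
  have hnorm : ∀ (r : ℝ≥0) (y : K), μ' {a : Kˣ | valuation K ((id a : Kˣ) : K) = 1 ∧ normAbs K (((id a : Kˣ) : K) * σ ((id a : Kˣ) : K) - y) ≤ r} ≤
      max C 1 * (r : ℝ≥0∞) ^ κ * μ' {a : Kˣ | valuation K (a : K) = 1} := by
    intro r y
    have h := measure_sep_le_clampedProfile μ' hκ (P := fun r a => normAbs K ((a : K) * σ (a : K) - y) ≤ r)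
      (fun r hr => by simpa only [mul_one] using ((hD r hr 1 y (map_one _)).2)) r
    simpa only [id] using h
  have h := measure_diagCollision_unitary_le_of_profile σ hσ hσn μ' id (fun r => max C 1 * (r : ℝ≥0∞) ^ κ * μ' {a : Kˣ | valuation K (a : K) = 1})
    hadd hnorm hρ g hg0 hg1 ε
  calc _ ≤ 3 * (max C 1 * ((ε / ρ : ℝ≥0) : ℝ≥0∞) ^ κ * μ' {a : Kˣ | valuation K (a : K) = 1}) := by simpa only [id] using h
    _ = 3 * max C 1 * ((ε / ρ : ℝ≥0) : ℝ≥0∞) ^ κ * μ' {a : Kˣ | valuation K ↑a = 1} := by ring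

end UnitsDigitFibre

end Summit.HodgeConjecture.HodgeConjecture.Cruxes.H413.K2E3DiagonalCollisionMeasure

end
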